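import Literature.NumberTheory.Automorphic.ArchRankinSelbergPairBridge
import HarnessLib

/-!
# The TRANSLATED unit-box Rankin–Selberg pair integral of two level-one cusp forms is an archimedean
integral (bridge for a number field with arbitrary different)

Topic `NumberTheory/Automorphic`; namespace `Literature.NumberTheory.Automorphic`. Theorems only.
`ArchRankinSelbergPairBridge` identifies the unit-box integral `∫_{𝕌_Kⁿ × K} W_{S_η f} W̄_{S_θ f'} Φ |det|^s δ_B⁻¹`
of two level-one smoothed cusp forms with an archimedean integral of Whittaker functions of the
archimedean components, using that on the unit box `W(diag(a) k) = W(g_∞)`, `g_∞ = (diag(a) k)_∞` — the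
form needed over a field with trivial different. Over a general number field the Euler factorisation at
the places above the different produces the LEFT TRANSLATE `W(T ·)` of the global Whittaker coefficient
by a finite-adelic element `T = (1, T_f)` (the torus of Whittaker shifts, `WhittakerShiftTorus`;
`RankinSelbergUnfoldedEulerCuspidalPairsTranslate`), and this file provides the corresponding bridge:

* `whittakerCoeff_smoothedForm_translate_torusPoint_eq_sum_transferMap`: on the unit box,
  `W_{S_η f}(T · diag(a) k) = Σ_i Φ_ℓ(S_i)(τ(g_∞) e_i)` with `e_i = S_i† R(T) R(η) f`, where `S_1, …, S_k`
  decompose the level-`U` piece `Π^U` for any compact open `U` with `T_f⁻¹ U T_f ≤ GL_n(𝒪̂)` (e.g. `U = T_f GL_n(𝒪̂) T_f⁻¹`)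
  (the finite part `u_f ∈ GL_n(𝒪̂)` of `diag(a) k` is killed on the RIGHT by the level-one invariance of
  `S_η f`, then the `u₀ = 1` form `whittakerCoeff_smoothedForm_eq_sum_transferMap_of_sndHom_eq` of the
  sum formula of `ArchRankinSelbergBridge` is applied at `g = (g_∞, T_f)`, the hypothesis `hleftg` coming
  from `T_f⁻¹ U T_f ≤ GL_n(𝒪̂)`);
* `setIntegral_unitBox_univ_torusPairIntegrandC_whittakerCoeff_translate_eq` (**main**): the unit-box
  integral of `W_{S_η f}(T ·) W̄_{S_θ f'}(T ·) Φ |det|^s δ_B⁻¹` equals the archimedean integral of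
  `ArchRankinSelbergPairBridge` with these `e_i`, `e'_j`;
* `setIntegral_unitBox_univ_torusPairIntegrandC_whittakerCoeff_translate_eq_archRankinSelbergPairIntegral`:
  single constituents.

Cogdell (2004), §2.3 and §3.1 ("if `ψ_v` is not normalized one translates the essential vector"), §4.1;
Jacquet–Shalika (1981), §4.

## References

* J. W. Cogdell, *Analytic theory of L-functions for GL_n* (2004), §2.3, §3.1, §4.1
  [CogdellAnalyticTheory2004].
* H. Jacquet, J. A. Shalika, Amer. J. Math. 103 (1981), §4 [JacquetShalikaAJM1981].
-/

noncomputable section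

open MeasureTheory Measure NumberField NumberField.mixedEmbedding IsDedekindDomain Set Filter
open Literature.NumberTheory.GaloisRepresentations (ideleGroup)
open scoped MatrixGroups ENNReal NNReal Classical ComplexConjugate

namespace Literature.NumberTheory.Automorphic

section CuspFormsTranslate

variable {n : ℕ} {K : Type} [Field K] [NumberField K]
  {μ : Measure (AdelicGroupData.gl n K).automorphicQuotient} [(AdelicGroupData.gl n K).IsAutomorphicMeasure μ]

attribute [local instance] adelicBorel borelSpace_adelic locallyCompactSpace_adelic secondCountableTopology_gl_adelic
  glAdeleBorel borelSpace_glAdele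

attribute [local instance] Literature.MeasureTheory.Group.hasSummableGeomSeries_of_finiteDimensional
  Literature.MeasureTheory.Group.Units.borelSpace_of_isOpenEmbedding
  Literature.MeasureTheory.Group.Units.secondCountableTopology
  Literature.MeasureTheory.Group.Units.locallyCompactSpace

attribute [local instance] secondCountableTopology_ideleGroup borelSpace_pi_mixedUnits measurableMul_pi_mixedUnits

omit [(AdelicGroupData.gl n K).IsAutomorphicMeasure μ] in
/-- **Right `(1, GL_n(𝒪̂))`-invariance of a level-one smoothed form**: for `η` left invariant under
`K(1)`, `φ = invQuot (S_η f)` satisfies `φ(y (1, u)) = φ(y)` for `u ∈ GL_n(𝒪̂_K)`. [folklore] -/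
theorem invQuot_smoothedForm_mul_ofFinite_of_levelOne {η : (AdelicGroupData.gl n K).Adelic → ℝ}
    (hηK : ∀ k : (AdelicGroupData.gl n K).Adelic, k ∈ principalCongruenceLevel n K ⊤ →
      ∀ g : (AdelicGroupData.gl n K).Adelic, η (k * g) = η g)
    (f : (AdelicGroupData.gl n K).L2 μ) {u : GL (Fin n) (FiniteAdeleRing (𝓞 K) K)}
    (hu : u ∈ glFiniteIntegralLevel n K) (y : GL (Fin n) (AdeleRing (𝓞 K) K)) :
    invQuot (AdelicGroupData.gl n K) (smoothedForm η f) (y * GLn.ofFinite n K u) =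
      invQuot (AdelicGroupData.gl n K) (smoothedForm η f) y := by
  have hmem : (GLn.ofFinite n K u)⁻¹ ∈ principalCongruenceLevel n K ⊤ := by
    rw [principalCongruenceLevel_top, ← map_inv]
    exact GLn.ofFinite_mem_glIntegralLevel ((glFiniteIntegralLevel n K).inv_mem hu)
  exact (invQuot_mul_eq_smul _ y _).trans
    ((smoothedForm_smul hηK f hmem _).trans (invQuot_apply _ _ _).symm)

/-- **`W_{S_η f}(g) = Σ_i Φ_ℓ(S_i)(τ(g_∞) e_i)`, `e_i = S_i† R((1,c)) R(η) f`, for `g = (g_∞, c)`** — the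
variant of `whittakerCoeff_smoothedForm_eq_sum_transferMap` with `u₀ = 1`, which needs the left
invariance of the weight `η(g⁻¹ ·)` under the level `U₀` of the decomposition but NOT that of `η` itself
(so that `U₀` may be a conjugate `c U c⁻¹` of the level `U` of `η`). [cite: CogdellAnalyticTheory2004, §1.2] -/
theorem whittakerCoeff_smoothedForm_eq_sum_transferMap_of_sndHom_eq (hcpt : isCompact_glFiniteIntegralLevel n K)
    (P : CuspidalAutomorphicRepGL n K μ)
    {E : Type*} [NormedAddCommGroup E] [InnerProductSpace ℂ E] [CompleteSpace E]
    {τ : ContRepresentation ℂ (AutomorphyDatum.gl n K hcpt).arch.carrier E}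
    (hτu : τ.IsUnitary) (hτi : τ.IsTopIrreducible) (hτc : τ.IsStronglyContinuous)
    (hex : ∃ T ∈ archIntertwiners hcpt τ P.1, T ≠ 0)
    {U₀ : Subgroup (GL (Fin n) (FiniteAdeleRing (𝓞 K) K))}
    (hU₀o : IsOpen (U₀ : Set (GL (Fin n) (FiniteAdeleRing (𝓞 K) K))))
    (hU₀c : IsCompact (U₀ : Set (GL (Fin n) (FiniteAdeleRing (𝓞 K) K))))
    {k : ℕ} {S : Fin k → E →L[ℂ] (AdelicGroupData.gl n K).L2 μ}
    (hS : ∀ i, S i ∈ archIntertwinersLevel hcpt τ P.1 U₀)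
    (hSon : ∀ i j, schurCoeff (μ := μ) (S i) (S j) = if i = j then 1 else 0)
    (hspan : ∀ T ∈ archIntertwinersLevel hcpt τ P.1 U₀, T ∈ Submodule.span ℂ (Set.range S))
    (ν₀ : Measure ↥(adelicUnipotent n K)) [IsHaarMeasure ν₀]
    {η : GL (Fin n) (AdeleRing (𝓞 K) K) → ℝ} (hη : IsTestFunctionGL n K η) (f : P.1.toSubmodule)
    {g : GL (Fin n) (AdeleRing (𝓞 K) K)} {c : GL (Fin n) (FiniteAdeleRing (𝓞 K) K)}
    (hg : GLn.sndHom n K g = c)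
    (hleftg : ∀ u ∈ U₀, ∀ x : GL (Fin n) (AdeleRing (𝓞 K) K),
      η (g⁻¹ * (GLn.ofFinite n K u * x)) = η (g⁻¹ * x))
    (e : Fin k → archGardingSpace hcpt τ)
    (he : ∀ i, (e i : E) = ContinuousLinearMap.adjoint (S i)
      ((P.1.toContRep (GLn.ofFinite n K c) (smoothedVector P.1 η f) : P.1.toSubmodule) :
        (AdelicGroupData.gl n K).L2 μ)) :
    whittakerCoeff ν₀ (unipotentTateDomain n K) (adeleAddChar K)
        (invQuot (AdelicGroupData.gl n K) (smoothedForm η (f : (AdelicGroupData.gl n K).L2 μ))) g =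
      ∑ i, transferMap (whittakerFunctional ν₀ (continuous_adeleAddChar K)
          (ContRepresentation.Equiv.refl P.1.toContRep)) hτc
          ⟨S i, mem_multiplicityModule_of_mem_archIntertwinersLevel hU₀o hU₀c (hS i)⟩
          ⟨τ (toArch hcpt (GLn.toMixed n K g)) (e i : E), apply_mem_archGardingSpace hτc _ (e i).2⟩ := by
  set u : P.1.toSubmodule := smoothedVector P.1 η f with hu_def
  have hu : u ∈ gardingSpace P.1 := smoothedVector_mem_gardingSpace hη f
  have hvsub : P.1.toContRep g u ∈ gardingSubspace P.1 U₀ := by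
    rw [hu_def, toContRep_smoothedVector_eq _ hη.continuous hη.hasCompactSupport g f]
    exact smoothedVector_mem_gardingSubspace (hη.comp_mul_left g⁻¹) hleftg f
  rw [← whittakerFunctional_toContRep_eq_whittakerCoeff ν₀ (continuous_adeleAddChar K) hu
    (hasContRep_smoothedVector P.1 hη.continuous hη.hasCompactSupport f) g,
    apply_eq_sum_transferMap P hτu hτi hτc hex hU₀o hU₀c hS hSon hspan _ hvsub
      (toContRep_mem_gardingSpace g hu)]
  refine Finset.sum_congr rfl fun i _ => ?_
  congr 1
  apply Subtype.ext
  change ContinuousLinearMap.adjoint (S i)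
      ((P.1.toContRep g u : P.1.toSubmodule) : (AdelicGroupData.gl n K).L2 μ) =
    τ (toArch hcpt (GLn.toMixed n K g)) (e i : E)
  -- `R(g) u = R((g_∞,1)) R((1,c)) u`
  have hmul : ∀ (a b : GL (Fin n) (AdeleRing (𝓞 K) K)) (x : P.1.toSubmodule),
      P.1.toContRep (a * b) x = P.1.toContRep a (P.1.toContRep b x) := fun a b x =>
    (DFunLike.congr_fun (map_mul P.1.toContRep a b) x).trans rfl
  have hgfac : g = GLn.ofInfinite n K (GLn.toMixed n K g) * GLn.ofFinite n K c := by
    rw [← hg, GLn.ofInfinite_toMixed_mul_ofFinite_sndHom]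
  have hfac : P.1.toContRep g u =
      P.1.toContRep (GLn.ofInfinite n K (GLn.toMixed n K g)) (P.1.toContRep (GLn.ofFinite n K c) u) := by
    conv_lhs => rw [hgfac]
    rw [hmul]
  rw [hfac, ContRepresentation.ClosedSubrep.coe_toContRep_apply, ← archRegular_toArch_apply (hcpt := hcpt),
    adjoint_apply_archRegular hτu (hS i).1, ← he i]

/-- **`W_{S_η f}(T · diag(a) k) = Σ_i Φ_ℓ(S_i)(τ((diag(a) k)_∞) e_i)`, `e_i = S_i† R(T) R(η) f`, on the box
`𝕌_Kⁿ × K`**, for a level-one `S_η f`, a finite-adelic `T = (1, T_f)` and a decomposition `S_1, …, S_k` of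
the level-`U` piece, `U` compact open with `T_f⁻¹ U T_f ≤ GL_n(𝒪̂)`.
[cite: CogdellAnalyticTheory2004, §1.2 and §3.1] -/
theorem whittakerCoeff_smoothedForm_translate_torusPoint_eq_sum_transferMap
    (hcpt : isCompact_glFiniteIntegralLevel n K) (P : CuspidalAutomorphicRepGL n K μ)
    {E : Type*} [NormedAddCommGroup E] [InnerProductSpace ℂ E] [CompleteSpace E]
    {τ : ContRepresentation ℂ (AutomorphyDatum.gl n K hcpt).arch.carrier E}
    (hτu : τ.IsUnitary) (hτi : τ.IsTopIrreducible) (hτc : τ.IsStronglyContinuous)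
    (hex : ∃ T ∈ archIntertwiners hcpt τ P.1, T ≠ 0)
    {U : Subgroup (GL (Fin n) (FiniteAdeleRing (𝓞 K) K))}
    (hUo : IsOpen (U : Set (GL (Fin n) (FiniteAdeleRing (𝓞 K) K))))
    (hUc : IsCompact (U : Set (GL (Fin n) (FiniteAdeleRing (𝓞 K) K))))
    (Tf : GL (Fin n) (FiniteAdeleRing (𝓞 K) K)) (hTU : ∀ u ∈ U, Tf⁻¹ * u * Tf ∈ glFiniteIntegralLevel n K)
    {k : ℕ} {S : Fin k → E →L[ℂ] (AdelicGroupData.gl n K).L2 μ}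
    (hS : ∀ i, S i ∈ archIntertwinersLevel hcpt τ P.1 U)
    (hSon : ∀ i j, schurCoeff (μ := μ) (S i) (S j) = if i = j then 1 else 0)
    (hspan : ∀ T ∈ archIntertwinersLevel hcpt τ P.1 U, T ∈ Submodule.span ℂ (Set.range S))
    (ν₀ : Measure ↥(adelicUnipotent n K)) [IsHaarMeasure ν₀]
    {η : GL (Fin n) (AdeleRing (𝓞 K) K) → ℝ} (hη : IsTestFunctionGL n K η) (f : P.1.toSubmodule)
    (hηK : ∀ k : (AdelicGroupData.gl n K).Adelic, k ∈ principalCongruenceLevel n K ⊤ →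
      ∀ g : (AdelicGroupData.gl n K).Adelic, η (k * g) = η g)
    (e : Fin k → archGardingSpace hcpt τ)
    (he : ∀ i, (e i : E) = ContinuousLinearMap.adjoint (S i)
      ((P.1.toContRep (GLn.ofFinite n K Tf) (smoothedVector P.1 η f) : P.1.toSubmodule) :
        (AdelicGroupData.gl n K).L2 μ))
    (p : (Fin n → ideleGroup K) × ↥(maximalCompactAdelic n K))
    (hp : p.1 ∈ unitBox (n := n) (K := K) (Set.univ : Set (HeightOneSpectrum (𝓞 K)))) :
    whittakerCoeff ν₀ (unipotentTateDomain n K) (adeleAddChar K)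
        (invQuot (AdelicGroupData.gl n K) (smoothedForm η (f : (AdelicGroupData.gl n K).L2 μ)))
        (GLn.ofFinite n K Tf * torusPoint n K p) =
      ∑ i, transferMap (whittakerFunctional ν₀ (continuous_adeleAddChar K)
          (ContRepresentation.Equiv.refl P.1.toContRep)) hτc
          ⟨S i, mem_multiplicityModule_of_mem_archIntertwinersLevel hUo hUc (hS i)⟩
          ⟨τ (toArch hcpt (GLn.toMixed n K (torusPoint n K p))) (e i : E), apply_mem_archGardingSpace hτc _ (e i).2⟩ := by
  set tp := torusPoint n K p with htp
  set ginf : GL (Fin n) (mixedSpace K) := GLn.toMixed n K tp with hginf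
  set u : GL (Fin n) (FiniteAdeleRing (𝓞 K) K) := GLn.sndHom n K tp with hu
  have hκ : u ∈ glFiniteIntegralLevel n K := by
    obtain ⟨a, kk⟩ := p
    exact sndHom_torusPoint_mem_glFiniteIntegralLevel hp kk
  -- `T · tp = ((g_∞, T_f)) · (1, u_f)`
  set g : GL (Fin n) (AdeleRing (𝓞 K) K) := GLn.ofInfinite n K ginf * GLn.ofFinite n K Tf with hgdef
  have hdec : GLn.ofFinite n K Tf * tp = g * GLn.ofFinite n K u := by
    conv_lhs => rw [← GLn.ofInfinite_toMixed_mul_ofFinite_sndHom tp]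
    rw [hgdef, ← mul_assoc, ← (GLn.commute_ofInfinite_ofFinite ginf Tf).eq]
  -- kill `(1, u_f)` on the right by the level-one invariance
  have hright : whittakerCoeff ν₀ (unipotentTateDomain n K) (adeleAddChar K)
      (invQuot (AdelicGroupData.gl n K) (smoothedForm η (f : (AdelicGroupData.gl n K).L2 μ))) (g * GLn.ofFinite n K u) =
      whittakerCoeff ν₀ (unipotentTateDomain n K) (adeleAddChar K)
        (invQuot (AdelicGroupData.gl n K) (smoothedForm η (f : (AdelicGroupData.gl n K).L2 μ))) g :=
    whittakerCoeff_mul_of_forall ν₀ _ _ (fun y => invQuot_smoothedForm_mul_ofFinite_of_levelOne hηK _ hκ y) g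
  rw [hdec, hright]
  -- the formula at `g = (g_∞, T_f)` with `c = T_f`
  have hsnd : GLn.sndHom n K g = Tf := by
    rw [hgdef, map_mul, GLn.sndHom_ofInfinite, one_mul, GLn.sndHom_ofFinite]
  have hleft : ∀ u ∈ glFiniteIntegralLevel n K, ∀ x : GL (Fin n) (AdeleRing (𝓞 K) K),
      η (GLn.ofFinite n K u * x) = η x := fun u hu x =>
    hηK _ (by rw [principalCongruenceLevel_top]; exact GLn.ofFinite_mem_glIntegralLevel hu) x
  have hleftg : ∀ v ∈ U, ∀ x : GL (Fin n) (AdeleRing (𝓞 K) K),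
      η (g⁻¹ * (GLn.ofFinite n K v * x)) = η (g⁻¹ * x) := by
    intro v hv x
    have key : g⁻¹ * GLn.ofFinite n K v = GLn.ofFinite n K (Tf⁻¹ * v * Tf) * g⁻¹ := by
      have hc' : (GLn.ofInfinite n K ginf)⁻¹ * GLn.ofFinite n K v =
          GLn.ofFinite n K v * (GLn.ofInfinite n K ginf)⁻¹ := by
        rw [← map_inv]; exact (GLn.commute_ofInfinite_ofFinite ginf⁻¹ v).eq
      rw [hgdef, map_mul, map_mul, map_inv, _root_.mul_inv_rev]
      conv_lhs => rw [mul_assoc, hc']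
      group
    rw [← mul_assoc, key, mul_assoc, hleft _ (hTU v hv)]
  have htm : GLn.toMixed n K g = ginf := by
    rw [hgdef, map_mul, GLn.toMixed_ofInfinite, GLn.toMixed_ofFinite, mul_one]
  have h := whittakerCoeff_smoothedForm_eq_sum_transferMap_of_sndHom_eq hcpt P hτu hτi hτc hex hUo hUc hS hSon hspan
    ν₀ hη f hsnd hleftg e he
  rw [htm] at h
  exact h

variable [MeasurableSpace (ideleGroup K)] [BorelSpace (ideleGroup K)]
  [MeasurableSpace (GL (Fin n) (mixedSpace K))] [BorelSpace (GL (Fin n) (mixedSpace K))]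

/-- **The translated unit-box pair integral of two level-one smoothed cusp forms is an archimedean
integral** (main): for `T = (1, T_f)` and decompositions `S`, `S'` of the level-`U` pieces (`U`
compact open with `T_f⁻¹ U T_f ≤ GL_n(𝒪̂)`),
`∫_{𝕌_Kⁿ × K} W_{S_η f}(T ·) conj(W_{S_θ f'}(T ·)) Φ(e_n ·) |det|^s δ_B⁻¹ d(νA × νK)` equals the archimedean
integral of `ArchRankinSelbergPairBridge` with `e_i = S_i† R(T) R(η) f`, `e'_j = S'_j† R(T) R(θ) f'`.
[cite: CogdellAnalyticTheory2004, §2.3, §3.1 and §4.1] [cite: JacquetShalikaAJM1981, §4] -/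
theorem setIntegral_unitBox_univ_torusPairIntegrandC_whittakerCoeff_translate_eq
    (hcpt : isCompact_glFiniteIntegralLevel n K) (P P' : CuspidalAutomorphicRepGL n K μ)
    {E : Type*} [NormedAddCommGroup E] [InnerProductSpace ℂ E] [CompleteSpace E]
    {τ : ContRepresentation ℂ (AutomorphyDatum.gl n K hcpt).arch.carrier E}
    (hτu : τ.IsUnitary) (hτi : τ.IsTopIrreducible) (hτc : τ.IsStronglyContinuous)
    (hex : ∃ T ∈ archIntertwiners hcpt τ P.1, T ≠ 0)
    {U : Subgroup (GL (Fin n) (FiniteAdeleRing (𝓞 K) K))}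
    (hUo : IsOpen (U : Set (GL (Fin n) (FiniteAdeleRing (𝓞 K) K))))
    (hUc : IsCompact (U : Set (GL (Fin n) (FiniteAdeleRing (𝓞 K) K))))
    (Tf : GL (Fin n) (FiniteAdeleRing (𝓞 K) K)) (hTU : ∀ u ∈ U, Tf⁻¹ * u * Tf ∈ glFiniteIntegralLevel n K)
    {k : ℕ} {S : Fin k → E →L[ℂ] (AdelicGroupData.gl n K).L2 μ}
    (hS : ∀ i, S i ∈ archIntertwinersLevel hcpt τ P.1 U)
    (hSon : ∀ i j, schurCoeff (μ := μ) (S i) (S j) = if i = j then 1 else 0)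
    (hspan : ∀ T ∈ archIntertwinersLevel hcpt τ P.1 U, T ∈ Submodule.span ℂ (Set.range S))
    {E' : Type*} [NormedAddCommGroup E'] [InnerProductSpace ℂ E'] [CompleteSpace E']
    {τ' : ContRepresentation ℂ (AutomorphyDatum.gl n K hcpt).arch.carrier E'}
    (hτu' : τ'.IsUnitary) (hτi' : τ'.IsTopIrreducible) (hτc' : τ'.IsStronglyContinuous)
    (hex' : ∃ T ∈ archIntertwiners hcpt τ' P'.1, T ≠ 0)
    {k' : ℕ} {S' : Fin k' → E' →L[ℂ] (AdelicGroupData.gl n K).L2 μ}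
    (hS' : ∀ j, S' j ∈ archIntertwinersLevel hcpt τ' P'.1 U)
    (hSon' : ∀ i j, schurCoeff (μ := μ) (S' i) (S' j) = if i = j then 1 else 0)
    (hspan' : ∀ T ∈ archIntertwinersLevel hcpt τ' P'.1 U, T ∈ Submodule.span ℂ (Set.range S'))
    (ν₀ : Measure ↥(adelicUnipotent n K)) [IsHaarMeasure ν₀]
    {η θ : GL (Fin n) (AdeleRing (𝓞 K) K) → ℝ} (hη : IsTestFunctionGL n K η) (hθ : IsTestFunctionGL n K θ)
    (hηK : ∀ c : (AdelicGroupData.gl n K).Adelic, c ∈ principalCongruenceLevel n K ⊤ →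
      ∀ g : (AdelicGroupData.gl n K).Adelic, η (c * g) = η g)
    (hθK : ∀ c : (AdelicGroupData.gl n K).Adelic, c ∈ principalCongruenceLevel n K ⊤ →
      ∀ g : (AdelicGroupData.gl n K).Adelic, θ (c * g) = θ g)
    (f : P.1.toSubmodule) (f' : P'.1.toSubmodule)
    (e : Fin k → archGardingSpace hcpt τ)
    (he : ∀ i, (e i : E) = ContinuousLinearMap.adjoint (S i)
      ((P.1.toContRep (GLn.ofFinite n K Tf) (smoothedVector P.1 η f) : P.1.toSubmodule) :
        (AdelicGroupData.gl n K).L2 μ))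
    (e' : Fin k' → archGardingSpace hcpt τ')
    (he' : ∀ j, (e' j : E') = ContinuousLinearMap.adjoint (S' j)
      ((P'.1.toContRep (GLn.ofFinite n K Tf) (smoothedVector P'.1 θ f') : P'.1.toSubmodule) :
        (AdelicGroupData.gl n K).L2 μ))
    {Φinf : (Fin n → InfiniteAdeleRing K) → ℝ} (hΦ : Continuous Φinf) (s : ℂ)
    (νA : Measure (Fin n → ideleGroup K)) [SFinite νA]
    (νK : Measure ↥(maximalCompactAdelic n K)) [SFinite νK] :
    ∫ p in unitBox (Set.univ : Set (HeightOneSpectrum (𝓞 K))) ×ˢ Set.univ,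
        torusPairIntegrandC n K
          (fun g => whittakerCoeff ν₀ (unipotentTateDomain n K) (adeleAddChar K)
            (invQuot (AdelicGroupData.gl n K) (smoothedForm η (f : (AdelicGroupData.gl n K).L2 μ)))
            (GLn.ofFinite n K Tf * g))
          (fun g => (star (whittakerCoeff ν₀ (unipotentTateDomain n K) (adeleAddChar K)
            (invQuot (AdelicGroupData.gl n K) (smoothedForm θ (f' : (AdelicGroupData.gl n K).L2 μ)))))
            (GLn.ofFinite n K Tf * g))
          (standardTestFun n K Φinf) s p ∂(νA.prod νK) =
      ∫ z, (∑ i, transferMap (whittakerFunctional ν₀ (continuous_adeleAddChar K)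
              (ContRepresentation.Equiv.refl P.1.toContRep)) hτc
              ⟨S i, mem_multiplicityModule_of_mem_archIntertwinersLevel hUo hUc (hS i)⟩
              ⟨τ (toArch hcpt (glDiagonal n (mixedSpace K) z.1 * (z.2 : GL (Fin n) (mixedSpace K)))) (e i : E),
                apply_mem_archGardingSpace hτc _ (e i).2⟩) *
          conj (∑ j, transferMap (whittakerFunctional ν₀ (continuous_adeleAddChar K)
              (ContRepresentation.Equiv.refl P'.1.toContRep)) hτc'
              ⟨S' j, mem_multiplicityModule_of_mem_archIntertwinersLevel hUo hUc (hS' j)⟩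
              ⟨τ' (toArch hcpt (glDiagonal n (mixedSpace K) z.1 * (z.2 : GL (Fin n) (mixedSpace K)))) (e' j : E'),
                apply_mem_archGardingSpace hτc' _ (e' j).2⟩) *
          ((Φinf (archLastRow n K (glDiagonal n (mixedSpace K) z.1 * (z.2 : GL (Fin n) (mixedSpace K)))) :
            ℝ) : ℂ) *
          archTorusWeightC n K s z.1
        ∂(((νA.restrict (unitBox (Set.univ : Set (HeightOneSpectrum (𝓞 K))))).map
          (archTorusOfIdele n K)).prod (νK.map (kinfOfMaximalCompact n K))) := by
  have hA : Continuous fun h : GL (Fin n) (mixedSpace K) =>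
      ∑ i, transferMap (whittakerFunctional ν₀ (continuous_adeleAddChar K)
        (ContRepresentation.Equiv.refl P.1.toContRep)) hτc
        ⟨S i, mem_multiplicityModule_of_mem_archIntertwinersLevel hUo hUc (hS i)⟩
        ⟨τ (toArch hcpt h) (e i : E), apply_mem_archGardingSpace hτc _ (e i).2⟩ :=
    continuous_finsetSum _ fun i _ =>
      continuous_transferMap_toArch hcpt hτc hUo hUc (hS i) ν₀ (continuous_adeleAddChar K) (e i)
  have hB : Continuous fun h : GL (Fin n) (mixedSpace K) =>
      conj (∑ j, transferMap (whittakerFunctional ν₀ (continuous_adeleAddChar K)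
        (ContRepresentation.Equiv.refl P'.1.toContRep)) hτc'
        ⟨S' j, mem_multiplicityModule_of_mem_archIntertwinersLevel hUo hUc (hS' j)⟩
        ⟨τ' (toArch hcpt h) (e' j : E'), apply_mem_archGardingSpace hτc' _ (e' j).2⟩) :=
    Complex.continuous_conj.comp (continuous_finsetSum _ fun j _ =>
      continuous_transferMap_toArch hcpt hτc' hUo hUc (hS' j) ν₀ (continuous_adeleAddChar K) (e' j))
  refine setIntegral_unitBox_univ_torusPairIntegrandC_eq_integral_map _ _ hA hB (fun p hp => ?_) (fun p hp => ?_)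
    hΦ s νA νK
  · exact whittakerCoeff_smoothedForm_translate_torusPoint_eq_sum_transferMap hcpt P hτu hτi hτc hex hUo hUc
      Tf hTU hS hSon hspan ν₀ hη f hηK e he p hp
  · show star (whittakerCoeff ν₀ (unipotentTateDomain n K) (adeleAddChar K)
        (invQuot (AdelicGroupData.gl n K) (smoothedForm θ (f' : (AdelicGroupData.gl n K).L2 μ)))
        (GLn.ofFinite n K Tf * torusPoint n K p)) = _
    rw [whittakerCoeff_smoothedForm_translate_torusPoint_eq_sum_transferMap hcpt P' hτu' hτi' hτc' hex' hUo
      hUc Tf hTU hS' hSon' hspan' ν₀ hθ f' hθK e' he' p hp]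
    rfl

/-- **Single archimedean constituents (translated form)**: if `e_i = 0` for `i ≠ i₀` and `e'_j = 0` for
`j ≠ j₀`, the translated unit-box pair integral is ONE archimedean local integral
`Ψ_∞(s; W_{e_{i₀}}, W̄'_{e'_{j₀}}, Φ_∞)`. [cite: CogdellAnalyticTheory2004, §2.3 and §4.1] -/
theorem setIntegral_unitBox_univ_torusPairIntegrandC_whittakerCoeff_translate_eq_archRankinSelbergPairIntegral
    (hcpt : isCompact_glFiniteIntegralLevel n K) (P P' : CuspidalAutomorphicRepGL n K μ)
    {E : Type*} [NormedAddCommGroup E] [InnerProductSpace ℂ E] [CompleteSpace E]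
    {τ : ContRepresentation ℂ (AutomorphyDatum.gl n K hcpt).arch.carrier E}
    (hτu : τ.IsUnitary) (hτi : τ.IsTopIrreducible) (hτc : τ.IsStronglyContinuous)
    (hex : ∃ T ∈ archIntertwiners hcpt τ P.1, T ≠ 0)
    {U : Subgroup (GL (Fin n) (FiniteAdeleRing (𝓞 K) K))}
    (hUo : IsOpen (U : Set (GL (Fin n) (FiniteAdeleRing (𝓞 K) K))))
    (hUc : IsCompact (U : Set (GL (Fin n) (FiniteAdeleRing (𝓞 K) K))))
    (Tf : GL (Fin n) (FiniteAdeleRing (𝓞 K) K)) (hTU : ∀ u ∈ U, Tf⁻¹ * u * Tf ∈ glFiniteIntegralLevel n K)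
    {k : ℕ} {S : Fin k → E →L[ℂ] (AdelicGroupData.gl n K).L2 μ}
    (hS : ∀ i, S i ∈ archIntertwinersLevel hcpt τ P.1 U)
    (hSon : ∀ i j, schurCoeff (μ := μ) (S i) (S j) = if i = j then 1 else 0)
    (hspan : ∀ T ∈ archIntertwinersLevel hcpt τ P.1 U, T ∈ Submodule.span ℂ (Set.range S))
    {E' : Type*} [NormedAddCommGroup E'] [InnerProductSpace ℂ E'] [CompleteSpace E']
    {τ' : ContRepresentation ℂ (AutomorphyDatum.gl n K hcpt).arch.carrier E'}
    (hτu' : τ'.IsUnitary) (hτi' : τ'.IsTopIrreducible) (hτc' : τ'.IsStronglyContinuous)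
    (hex' : ∃ T ∈ archIntertwiners hcpt τ' P'.1, T ≠ 0)
    {k' : ℕ} {S' : Fin k' → E' →L[ℂ] (AdelicGroupData.gl n K).L2 μ}
    (hS' : ∀ j, S' j ∈ archIntertwinersLevel hcpt τ' P'.1 U)
    (hSon' : ∀ i j, schurCoeff (μ := μ) (S' i) (S' j) = if i = j then 1 else 0)
    (hspan' : ∀ T ∈ archIntertwinersLevel hcpt τ' P'.1 U, T ∈ Submodule.span ℂ (Set.range S'))
    (ν₀ : Measure ↥(adelicUnipotent n K)) [IsHaarMeasure ν₀]
    {η θ : GL (Fin n) (AdeleRing (𝓞 K) K) → ℝ} (hη : IsTestFunctionGL n K η) (hθ : IsTestFunctionGL n K θ)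
    (hηK : ∀ c : (AdelicGroupData.gl n K).Adelic, c ∈ principalCongruenceLevel n K ⊤ →
      ∀ g : (AdelicGroupData.gl n K).Adelic, η (c * g) = η g)
    (hθK : ∀ c : (AdelicGroupData.gl n K).Adelic, c ∈ principalCongruenceLevel n K ⊤ →
      ∀ g : (AdelicGroupData.gl n K).Adelic, θ (c * g) = θ g)
    (f : P.1.toSubmodule) (f' : P'.1.toSubmodule)
    (e : Fin k → archGardingSpace hcpt τ)
    (he : ∀ i, (e i : E) = ContinuousLinearMap.adjoint (S i)
      ((P.1.toContRep (GLn.ofFinite n K Tf) (smoothedVector P.1 η f) : P.1.toSubmodule) :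
        (AdelicGroupData.gl n K).L2 μ))
    (e' : Fin k' → archGardingSpace hcpt τ')
    (he' : ∀ j, (e' j : E') = ContinuousLinearMap.adjoint (S' j)
      ((P'.1.toContRep (GLn.ofFinite n K Tf) (smoothedVector P'.1 θ f') : P'.1.toSubmodule) :
        (AdelicGroupData.gl n K).L2 μ))
    {i₀ : Fin k} (he0 : ∀ i, i ≠ i₀ → e i = 0) {j₀ : Fin k'} (he0' : ∀ j, j ≠ j₀ → e' j = 0)
    {Φinf : (Fin n → InfiniteAdeleRing K) → ℝ} (hΦ : Continuous Φinf) (s : ℂ)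
    (νA : Measure (Fin n → ideleGroup K)) [SFinite νA]
    (νK : Measure ↥(maximalCompactAdelic n K)) [SFinite νK] :
    ∫ p in unitBox (Set.univ : Set (HeightOneSpectrum (𝓞 K))) ×ˢ Set.univ,
        torusPairIntegrandC n K
          (fun g => whittakerCoeff ν₀ (unipotentTateDomain n K) (adeleAddChar K)
            (invQuot (AdelicGroupData.gl n K) (smoothedForm η (f : (AdelicGroupData.gl n K).L2 μ)))
            (GLn.ofFinite n K Tf * g))
          (fun g => (star (whittakerCoeff ν₀ (unipotentTateDomain n K) (adeleAddChar K)
            (invQuot (AdelicGroupData.gl n K) (smoothedForm θ (f' : (AdelicGroupData.gl n K).L2 μ)))))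
            (GLn.ofFinite n K Tf * g))
          (standardTestFun n K Φinf) s p ∂(νA.prod νK) =
      archRankinSelbergPairIntegral hcpt τ hτc τ' hτc'
        (transferMap (whittakerFunctional ν₀ (continuous_adeleAddChar K)
          (ContRepresentation.Equiv.refl P.1.toContRep)) hτc
          ⟨S i₀, mem_multiplicityModule_of_mem_archIntertwinersLevel hUo hUc (hS i₀)⟩)
        (transferMap (whittakerFunctional ν₀ (continuous_adeleAddChar K)
          (ContRepresentation.Equiv.refl P'.1.toContRep)) hτc'
          ⟨S' j₀, mem_multiplicityModule_of_mem_archIntertwinersLevel hUo hUc (hS' j₀)⟩)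
        (e i₀) (e' j₀) Φinf
        (((νA.restrict (unitBox (Set.univ : Set (HeightOneSpectrum (𝓞 K))))).map (archTorusOfIdele n K)))
        (νK.map (kinfOfMaximalCompact n K)) s := by
  rw [setIntegral_unitBox_univ_torusPairIntegrandC_whittakerCoeff_translate_eq hcpt P P' hτu hτi hτc hex hUo hUc
    Tf hTU hS hSon hspan hτu' hτi' hτc' hex' hS' hSon' hspan' ν₀ hη hθ hηK hθK f f' e he e' he' hΦ s νA νK,
    archRankinSelbergPairIntegral_def]
  congr 1 with z
  have h1 : ∀ i, i ≠ i₀ → transferMap (whittakerFunctional ν₀ (continuous_adeleAddChar K)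
      (ContRepresentation.Equiv.refl P.1.toContRep)) hτc
      ⟨S i, mem_multiplicityModule_of_mem_archIntertwinersLevel hUo hUc (hS i)⟩
      ⟨τ (toArch hcpt (glDiagonal n (mixedSpace K) z.1 * (z.2 : GL (Fin n) (mixedSpace K)))) (e i : E),
        apply_mem_archGardingSpace hτc _ (e i).2⟩ = 0 := fun i hi => by
    have h0 : (⟨τ (toArch hcpt (glDiagonal n (mixedSpace K) z.1 * (z.2 : GL (Fin n) (mixedSpace K)))) (e i : E),
        apply_mem_archGardingSpace hτc _ (e i).2⟩ : archGardingSpace hcpt τ) = 0 := by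
      apply Subtype.ext
      change τ _ (e i : E) = 0
      rw [he0 i hi, Submodule.coe_zero, map_zero]
    rw [h0, map_zero]
  have h2 : ∀ j, j ≠ j₀ → transferMap (whittakerFunctional ν₀ (continuous_adeleAddChar K)
      (ContRepresentation.Equiv.refl P'.1.toContRep)) hτc'
      ⟨S' j, mem_multiplicityModule_of_mem_archIntertwinersLevel hUo hUc (hS' j)⟩
      ⟨τ' (toArch hcpt (glDiagonal n (mixedSpace K) z.1 * (z.2 : GL (Fin n) (mixedSpace K)))) (e' j : E'),
        apply_mem_archGardingSpace hτc' _ (e' j).2⟩ = 0 := fun j hj => by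
    have h0 : (⟨τ' (toArch hcpt (glDiagonal n (mixedSpace K) z.1 * (z.2 : GL (Fin n) (mixedSpace K)))) (e' j : E'),
        apply_mem_archGardingSpace hτc' _ (e' j).2⟩ : archGardingSpace hcpt τ') = 0 := by
      apply Subtype.ext
      change τ' _ (e' j : E') = 0
      rw [he0' j hj, Submodule.coe_zero, map_zero]
    rw [h0, map_zero]
  rw [Finset.sum_eq_single i₀ (fun i _ hi => h1 i hi) (fun h => absurd (Finset.mem_univ i₀) h),
    Finset.sum_eq_single j₀ (fun j _ hj => h2 j hj) (fun h => absurd (Finset.mem_univ j₀) h)]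

end CuspFormsTranslate

end Literature.NumberTheory.Automorphic
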